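import Literature.NumberTheory.EllipticCurves.HeegnerPointsGrossZagierProofs
import Literature.NumberTheory.EllipticCurves.HeegnerPointsImaginaryQuadraticProofs
import Literature.NumberTheory.EllipticCurves.ModularDegreeFormulaProofs
import Literature.NumberTheory.EllipticCurves.ModularCurveGamma0IndexProofs
import Mathlib.NumberTheory.NumberField.DedekindZeta
import Mathlib.NumberTheory.LSeries.HurwitzZetaValues
import HarnessLib

/-!
# Cai–Shu–Tian 2014, Thm. 1.1 (`CaiShuTian2014_explicitGrossZagier`): the formalisable leaf of its proof

Sibling proof file of `Literature/NumberTheory/EllipticCurves/HeegnerPointsGrossZagierProofs.lean`.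
The named fact `Literature.NumberTheory.EllipticCurves.CaiShuTian2014_explicitGrossZagier`
(Cai–Shu–Tian 2014, Thm. 1.1 for the trivial ring class character) is, in the cited source,
obtained along the chain

* Thm. 1.1 ⇐ the "Example" after Thm. 1.5 (`B = M₂(ℚ)`, `X_U = X₀(N)`, any `ℚ`-morphism
  `f : X₀(N) → E` with `f(∞) = O` is a test vector in `V(π_E, χ)`) ⇐ Thm. 1.5, special case 2
  (explicit Gross–Zagier formula on Shimura curves over a totally real field);
* Thm. 1.5 ⇐ (§2.4) Yuan–Zhang–Zhang 2013, Thm. 1.2 (the general Gross–Zagier formula,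
  `⟨P_χ(f₁), P_{χ⁻¹}(f₂)⟩ / (Vol(X_U)⁻¹ (f₁, f₂)_U) = L'(1/2, π, χ) / (L(1, π, ad) L(2, 1_F)⁻¹) · ∏ᵥ βᵥ`)
  combined with Prop. 2.1 (Petersson norm versus `L(1, π, ad)`), Lemma 2.2 (volume of `X_U`),
  Lemma 2.3 (relative class number formula, passing from the adelic period `P_χ` to the finite
  sum `P⁰_χ`) and the local toric-integral computations of §3 (Props. 3.11, 3.12, Lemmas 3.13,
  3.14).

Of these inputs only Lemma 2.3 is expressible over Mathlib today (2026-08): automorphic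
representations of quaternion algebras over the adeles, their Rankin–Selberg and adjoint
`L`-functions, Shimura curves with their CM points, and Néron–Tate heights on abelian varieties
are all absent.  This file vendors and *proves* the case of Lemma 2.3 that enters Thm. 1.1
(`F = ℚ`, `b = 1`, `K` imaginary quadratic), where it is the source of the factor `u² √|D|` in
the denominator of the printed constant `8π² (φ, φ) / (u² √|D c²|)` (via `(2 L(1, η) √|D| ν₁⁻¹)²`,
`ν₁ = u`, loc. cit. §2.4 (i)).  Printed (Lemma 2.3):
`L^{(b)}(1, η) · ‖D_{K/F} b² δ‖^{1/2} · 2^{-r_{K/F}} = #Pic_{K/F}(𝒪_b) · R_b / (#κ_b · w_b)`,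
proved there from the class number formulae
`Res_{s=1} L(s, 1_K) = 2^{r_K + 1} R_K h_K / (w_K √|D_K|)` for `K` and `F`
(complete `L`-functions).  For `F = ℚ`, `b = 1`: `r_{K/ℚ} = 0`, `R_1 = 1`, `κ_1 = 1`,
`#Pic_{K/ℚ}(𝒪_K) = h_K`, `w_1 = [𝒪_{K,tor}^× : ℤ^×] = w_K / 2 = u`, `δ = 1`, so the lemma reads
`L(1, η) √|D_K| = h_K / u` for the complete `L(1, η) = L_fin(1, η) / π`, i.e.
`L_fin(1, η_K) = Res_{s=1} ζ_K(s) = π h_K / (u √|D_K|) = 2π h_K / (w_K √|D_K|)`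
(`ζ_K = ζ · L(η_K)`, `Res_{s=1} ζ = 1`).  In Mathlib's vocabulary the residue of `ζ_K` is
`NumberField.dedekindZeta_residue K = 2^{r₁} (2π)^{r₂} R_K h_K / (w_K √|d_K|)` with the class
number formula `NumberField.tendsto_sub_one_mul_dedekindZeta_nhdsGT`; we prove

* `IsImaginaryQuadratic.regulator_eq_one`: `R_K = 1` (unit rank `0`, empty regulator matrix);
* `IsImaginaryQuadratic.dedekindZeta_residue_eq`: `Res_{s=1} ζ_K = 2π h_K / (w_K √|d_K|)`;
* `CaiShuTian2014_relClassNumberFormula_rat` (named statement, Lemma 2.3 for `F = ℚ`, `b = 1`,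
  in the `u = w_K/2` normalisation of Thm. 1.1: `(s - 1) ζ_K(s) → π h_K / (u √|d_K|)`), and its
  discharge `CaiShuTian2014_relClassNumberFormula_rat_holds`.

**Lemma 2.2 (volume of `X_U`), case `F = ℚ`, `B = M₂(ℚ)`, `U = U₀(N)`.**  Printed
(loc. cit. Lemma 2.2, second display): for an open compact `U ⊆ B̂^×` containing `𝒪̂^×`,
`Vol(X_U) = 2 (4π²)^{-d} |D_F|^{-1/2} h_F Vol(U)⁻¹`, where `Vol(X_U)` is the volume of
`X_U = B^×_+ \ ℋ₂^s × ℋ₃^t × B̂^× / U` for the measure `dx dy / (4π y²)` on `ℋ₂` (loc. cit. §1,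
definition of `Vol(X_U)` before Thm. 1.5) and `Vol(U)` is the Tamagawa volume normalised by
`Vol(GL₂(𝒪_v)) = L(2, 1_v)⁻¹ Vol(𝒪_v)⁴`.  For `F = ℚ` (`d = 1`, `D_ℚ = 1`, `h_ℚ = 1`),
`B = M₂(ℚ)` and `U = U₀(N)` (the unit group of the completed Eichler order of level `N`, so
`det U = ℤ̂^×` and `X_U = Γ₀(N) \ ℋ` is connected) one has
`Vol(U₀(N)) = ∏_p (1 - p⁻²) / [GL₂(ℤ_p) : U₀(N)_p] = ζ(2)⁻¹ / ψ(N)` with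
`ψ(N) = [SL₂(ℤ) : Γ₀(N)] = ∏_{p^e ∥ N} p^{e-1}(p + 1)` (`gamma0Index`,
`index_gamma0_eq_gamma0Index_holds`), and the lemma reads
`Area_{dx dy/y²}(Γ₀(N) \ ℋ) / (4π) = 2 (4π²)⁻¹ ζ(2) ψ(N) = ψ(N) / 12`, i.e. the classical
`V_{Γ₀(N)} = [SL₂(ℤ) : {±1}Γ₀(N)] V_{SL₂(ℤ)} = ψ(N) · π/3` (Diamond–Shurman (5.15), p. 182, with
`V_{SL₂(ℤ)} = π/3`, `Literature.NumberTheory.Automorphic.volume_modular_fd`).  This is the volume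
by which Yuan–Zhang–Zhang normalise the Petersson pairing `Vol(X_U)⁻¹ (f₁, f₂)_U` in the formula
quoted in §2.4, whereas Thm. 1.1 (`CaiShuTian2014_explicitGrossZagier`) and the tree's
`peterssonProduct` carry no volume factor.  We prove it for the fundamental domain
`F = ⋃_q g_q⁻¹ 𝒟ᵒ` of `Γ₀(N)` attached to any system `g` of coset representatives
(`ModularDegreeFormulaDomainProofs.lean`, the domain over which
`peterssonProduct (Gamma0 N) 2 f f = ∬_F |f|² dx dy`):

* `natCard_quotient_subgroupOf_eq_index`: `#(𝒮ℒ / Γ) = [SL₂(ℤ) : Γ]` for the image in `GL(2, ℝ)`;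
* `volume_iUnion_setOf_smul_mem_fdo`: `vol(F) = #(𝒮ℒ / Γ₀(N)) · vol(𝒟)`;
* `volume_gamma0Domain`: `vol(F) = [SL₂(ℤ) : Γ₀(N)] · π/3` (Diamond–Shurman (5.15));
* `CaiShuTian2014_vol_X0_eq`: `vol(F) / (4π) = 2 (4π²)⁻¹ ζ(2) ψ(N)` (Lemma 2.2 as printed, with
  Mathlib's `riemannZeta 2 = π²/6`) and `CaiShuTian2014_vol_X0_eq_div_twelve`: `= ψ(N)/12`.

**The printed formula versus `gross_zagier`, unconditionally.**  Since Zagier's identity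
`4π² c² (f, f) = deg(φ) covol(Λ_E)` is now a theorem of the tree
(`ModularParametrizationData.zagier_degree_formula_holds`, `ModularDegreeFormulaProofs.lean`),
the hypothesis `h₂` of `gross_zagier_of_explicit` / `explicitGrossZagier_iff_gross_zagier`
(`HeegnerPointsGrossZagierProofs.lean`) is discharged: `CaiShuTian2014_explicitGrossZagier N W K ↔
gross_zagier N W K` outright (`CaiShuTian2014_explicitGrossZagier_iff_gross_zagier`), so a
discharge of either named fact discharges the other.

The remaining nodes of the chain are recorded, with the precise missing theories, in the
literature-prover notes of the unit `provefact-…CaiShuTian2014_explicitGrossZagier`; the target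
`CaiShuTian2014_explicitGrossZagier_holds` is not reachable before those theories exist.

## References

* L. Cai, J. Shu, Y. Tian, *Explicit Gross–Zagier and Waldspurger formulae*, Algebra Number
  Theory 8 (2014), 2523–2572, Thm. 1.1, Thm. 1.5, §2.3 Lemma 2.3, §2.4. [CaiShuTian2014]
* X. Yuan, S.-W. Zhang, W. Zhang, *The Gross–Zagier formula on Shimura curves*, Ann. of Math.
  Studies 184 (2013), Thm. 1.2. [YuanZhangZhang2013]
* F. Diamond, J. Shurman, *A First Course in Modular Forms*, GTM 228, Springer 2005, §5.4,
  (5.15), p. 182. [DiamondShurman2005]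
* D. Zagier, *Modular parametrizations of elliptic curves*, Canad. Math. Bull. 28 (1985),
  372–384, §1. [ZagierCMB1985]
-/

noncomputable section

open scoped Classical Real

open NumberField NumberField.InfinitePlace NumberField.Units Filter Topology

universe u

namespace Literature.NumberTheory.EllipticCurves

section ClassNumberLeaf

variable {K : Type u} [Field K] [NumberField K]

namespace IsImaginaryQuadratic

/-- The regulator of an imaginary quadratic field is `1`: the unit rank `r₁ + r₂ - 1` is `0`
(`IsImaginaryQuadratic.unitsRank_eq_zero`), so the regulator is the absolute value of the
determinant of the empty matrix (Mathlib `NumberField.Units.regulator_eq_det`).  This is the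
value `R_K = 1` (and `R_b = 1`) used in Cai–Shu–Tian 2014, Lemma 2.3 for `F = ℚ`.
[cite: CaiShuTian2014, Lemma 2.3 (proof)] -/
theorem regulator_eq_one (hK : IsImaginaryQuadratic K) : regulator K = 1 := by
  obtain ⟨w₀⟩ : Nonempty (InfinitePlace K) := inferInstance
  have hsub : ∀ w : InfinitePlace K, w = w₀ := fun w ↦
    Fintype.card_le_one_iff.mp hK.card_infinitePlace_eq_one.le w w₀
  haveI : IsEmpty {w : InfinitePlace K // w ≠ w₀} := ⟨fun w ↦ w.2 (hsub w.1)⟩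
  haveI : IsEmpty (Fin (rank K)) := by
    rw [hK.unitsRank_eq_zero]
    infer_instance
  rw [regulator_eq_det K w₀ (Equiv.equivOfIsEmpty _ _), Matrix.det_isEmpty, abs_one]

/-- **Class number formula for an imaginary quadratic field** (the case `r₁ = 0`, `r₂ = 1`,
`R_K = 1` of `Res_{s=1} ζ_K(s) = 2^{r₁} (2π)^{r₂} R_K h_K / (w_K √|d_K|)`): the residue of the
Dedekind zeta function of `K` at `s = 1` is `2π h_K / (w_K √|d_K|)`, where `h_K` is the class
number, `w_K = #𝒪_K^×` and `d_K` the discriminant (Mathlib `NumberField.dedekindZeta_residue`).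
Printed in Cai–Shu–Tian 2014, proof of Lemma 2.3, as `Res_{s=1} L(s, 1_K) = 2^{r_K+1} R_K h_K /
(w_K √|D_K|)` for the complete zeta function (`r_K = 0`; the archimedean factor `Γ_ℂ(1) = π⁻¹`
accounts for `2` versus `2π`). [cite: CaiShuTian2014, Lemma 2.3 (proof, class number formula)] -/
theorem dedekindZeta_residue_eq (hK : IsImaginaryQuadratic K) :
    dedekindZeta_residue K = 2 * π * classNumber K / (torsionOrder K * √|(discr K : ℝ)|) := by
  rw [dedekindZeta_residue_def, hK.nrRealPlaces_eq_zero, hK.nrComplexPlaces_eq_one,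
    hK.regulator_eq_one, pow_zero, pow_one, one_mul, mul_one]

/-- Class number formula for an imaginary quadratic field, limit form:
`(s - 1) ζ_K(s) → 2π h_K / (w_K √|d_K|)` as `s → 1⁺` (Mathlib
`NumberField.tendsto_sub_one_mul_dedekindZeta_nhdsGT` with `dedekindZeta_residue_eq`).
[cite: CaiShuTian2014, Lemma 2.3 (proof, class number formula)] -/
theorem tendsto_sub_one_mul_dedekindZeta (hK : IsImaginaryQuadratic K) :
    Tendsto (fun s : ℝ ↦ (s - 1) * dedekindZeta K s) (𝓝[>] 1)
      (𝓝 ((2 * π * classNumber K / (torsionOrder K * √|(discr K : ℝ)|) : ℝ) : ℂ)) := by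
  rw [← hK.dedekindZeta_residue_eq]
  exact tendsto_sub_one_mul_dedekindZeta_nhdsGT K

/-- The vendored form of Cai–Shu–Tian 2014, Lemma 2.3 (`F = ℚ`, `b = 1`) agrees with the residue:
under `IsImaginaryQuadratic K`, `π h_K / (u √|d_K|) = NumberField.dedekindZeta_residue K` with
`u = w_K / 2`. [cite: CaiShuTian2014, Lemma 2.3] -/
theorem pi_mul_classNumber_div_eq_dedekindZeta_residue (hK : IsImaginaryQuadratic K) :
    π * classNumber K / ((torsionOrder K : ℝ) / 2 * √|(discr K : ℝ)|) = dedekindZeta_residue K := by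
  have hw : (torsionOrder K : ℝ) ≠ 0 := by exact_mod_cast (torsionOrder_pos K).ne'
  have hd : √|(discr K : ℝ)| ≠ 0 :=
    (Real.sqrt_pos.mpr (abs_pos.mpr (by exact_mod_cast discr_ne_zero K))).ne'
  rw [hK.dedekindZeta_residue_eq]
  field_simp

end IsImaginaryQuadratic

end ClassNumberLeaf

section RelativeClassNumberFormula

/-- **Relative class number formula, case `F = ℚ`, `b = 1`** (L. Cai, J. Shu, Y. Tian,
*Explicit Gross–Zagier and Waldspurger formulae*, Algebra Number Theory 8 (2014), Lemma 2.3).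
Printed statement: for a CM extension `K/F`, a non-zero ideal `b ⊆ 𝒪 = 𝒪_F` and
`Pic_{K/F}(𝒪_b) = K̂^× / K^× F̂^× 𝒪̂_b^×`,
`L^{(b)}(1, η) · ‖D_{K/F} b² δ‖^{1/2} · 2^{-r_{K/F}} = #Pic_{K/F}(𝒪_b) · R_b / (#κ_b · w_b)`,
where `η` is the quadratic character of `K/F`, `r_{K/F} = rank 𝒪_K^× - rank 𝒪^×`,
`w_b = [𝒪_{b,tor}^× : 𝒪_tor^×]`, `R_b` the quotient of regulators and `κ_b = ker(Pic(𝒪) → Pic(𝒪_b))`;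
all `L`-functions complete.  Here `F = ℚ`, `b = 1`, `K` imaginary quadratic: `r_{K/ℚ} = 0`,
`R_1 = 1` (`IsImaginaryQuadratic.regulator_eq_one`), `κ_1 = 1`, `#Pic_{K/ℚ}(𝒪_K) = h_K`,
`w_1 = w_K / 2 = u` (the `u = [𝒪_K^× : ℤ^×]` of Thm. 1.1), `δ = 1`, and the complete
`L(1, η) = L_fin(1, η) · Γ_ℝ(2)|_{s=1}`-normalisation gives `L(1, η) = L_fin(1, η)/π`; with
`ζ_K(s) = ζ(s) L_fin(s, η)` and `Res_{s=1} ζ = 1` the lemma becomes the residue statement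
`lim_{s→1⁺} (s - 1) ζ_K(s) = π h_K / (u √|d_K|)`, `u = w_K/2`, which is the form vendored here
(Mathlib `NumberField.dedekindZeta`, `classNumber`, `Units.torsionOrder`, `discr`).  This is the
input of loc. cit. §2.4 (i) (`ν_{c₁} = 2^{1-d} u₁`) producing the factor `u² √|D|` of Thm. 1.1
(`CaiShuTian2014_explicitGrossZagier`).  A closed statement (all imaginary quadratic number
fields `K` in `Type u`); discharged below. [cite: CaiShuTian2014, Lemma 2.3] -/
def CaiShuTian2014_relClassNumberFormula_rat : Prop :=
  ∀ (K : Type u) [Field K] [NumberField K], IsImaginaryQuadratic K →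
    Tendsto (fun s : ℝ ↦ (s - 1) * dedekindZeta K s) (𝓝[>] 1)
      (𝓝 ((π * classNumber K / ((torsionOrder K : ℝ) / 2 * √|(discr K : ℝ)|) : ℝ) : ℂ))

/-- **Discharge** of `CaiShuTian2014_relClassNumberFormula_rat` (Cai–Shu–Tian 2014, Lemma 2.3 for
`F = ℚ`, `b = 1`) from Mathlib's class number formula
`NumberField.tendsto_sub_one_mul_dedekindZeta_nhdsGT` and `r₁ = 0`, `r₂ = 1`, `R_K = 1`
(`IsImaginaryQuadratic.dedekindZeta_residue_eq`): `2π h/(w √|d|) = π h/((w/2) √|d|)`.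
[cite: CaiShuTian2014, Lemma 2.3] -/
theorem CaiShuTian2014_relClassNumberFormula_rat_holds :
    CaiShuTian2014_relClassNumberFormula_rat := by
  intro K _ _ hK
  rw [hK.pi_mul_classNumber_div_eq_dedekindZeta_residue]
  exact tendsto_sub_one_mul_dedekindZeta_nhdsGT K

/-- Pointwise form of `CaiShuTian2014_relClassNumberFormula_rat` for one imaginary quadratic field
`K` (Cai–Shu–Tian 2014, Lemma 2.3, `F = ℚ`, `b = 1`): `(s - 1) ζ_K(s) → π h_K / (u √|d_K|)`,
`u = w_K / 2`. [cite: CaiShuTian2014, Lemma 2.3] -/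
theorem IsImaginaryQuadratic.tendsto_sub_one_mul_dedekindZeta' {K : Type u} [Field K]
    [NumberField K] (hK : IsImaginaryQuadratic K) :
    Tendsto (fun s : ℝ ↦ (s - 1) * dedekindZeta K s) (𝓝[>] 1)
      (𝓝 ((π * classNumber K / ((torsionOrder K : ℝ) / 2 * √|(discr K : ℝ)|) : ℝ) : ℂ)) :=
  CaiShuTian2014_relClassNumberFormula_rat_holds K hK

end RelativeClassNumberFormula

section VolumeLeaf

/-! ### Cai–Shu–Tian 2014, Lemma 2.2 for `F = ℚ`, `U = U₀(N)`: the volume of `X₀(N)` -/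

open scoped MatrixGroups Modular ENNReal

open MeasureTheory CongruenceSubgroup ModularGroup UpperHalfPlane ModularForms

/-- For a subgroup `Γ ≤ SL(2, ℤ)`, the coset space of its image in `GL(2, ℝ)` inside the image `𝒮ℒ`
of `SL(2, ℤ)` (the index set of the sum defining `peterssonProduct`) has `[SL(2, ℤ) : Γ]` elements
(`mapGL` is injective; Mathlib `Subgroup.relIndex_map_map_of_injective`).  Both sides are `0`
when the index is infinite. [folklore] -/
theorem natCard_quotient_subgroupOf_eq_index (Γ : Subgroup SL(2, ℤ)) :
    Nat.card (↥𝒮ℒ ⧸ (Γ : Subgroup (GL (Fin 2) ℝ)).subgroupOf 𝒮ℒ) = Γ.index := by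
  rw [← Subgroup.index_eq_card]
  change (Subgroup.map (Matrix.SpecialLinearGroup.mapGL ℝ) Γ).relIndex 𝒮ℒ = Γ.index
  rw [MonoidHom.range_eq_map, Subgroup.relIndex_map_map_of_injective _ _
    Matrix.SpecialLinearGroup.mapGL_injective, Subgroup.relIndex_top_right]

variable {N : ℕ}
  (g : (↥𝒮ℒ ⧸ (Gamma0 N : Subgroup (GL (Fin 2) ℝ)).subgroupOf 𝒮ℒ) → SL(2, ℤ))
  (hg : ∀ q, (Matrix.SpecialLinearGroup.mapGL ℝ (g q) : GL (Fin 2) ℝ) =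
    ((q.out : ↥𝒮ℒ) : GL (Fin 2) ℝ))

include hg in
/-- **`vol(F) = #(𝒮ℒ / Γ₀(N)) · vol(𝒟)`** for the domain `F = ⋃_q g_q⁻¹ 𝒟ᵒ` of `Γ₀(N)` built from
coset representatives `g_q ∈ SL(2, ℤ)` (`ModularDegreeFormulaDomainProofs.lean`): the translates
`g_q⁻¹ 𝒟ᵒ` are pairwise disjoint (`pairwise_disjoint_smul_fdo`), each of hyperbolic measure
`vol(𝒟ᵒ) = vol(𝒟)` (invariance of `dx dy / y²`, `vol(𝒟 ∖ 𝒟ᵒ) = 0`); formally the unfolding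
identity `∫_𝒟 ∑_q G(g_q⁻¹ τ) dμ = ∫_F G dμ` (`setLIntegral_fd_sum_eq_setLIntegral_iUnion`) at
`G = 1` (Diamond–Shurman §5.4, p. 182: `∫_{X(Γ)} φ dμ = ∑_j ∫_𝒟 φ(α_j τ) dμ` with `φ = 1`).
[cite: DiamondShurman2005, §5.4, (5.15), p. 182] -/
theorem volume_iUnion_setOf_smul_mem_fdo
    [Fintype (↥𝒮ℒ ⧸ (Gamma0 N : Subgroup (GL (Fin 2) ℝ)).subgroupOf 𝒮ℒ)] :
    volume (⋃ q, {τ : ℍ | g q • τ ∈ 𝒟ᵒ}) =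
      Fintype.card (↥𝒮ℒ ⧸ (Gamma0 N : Subgroup (GL (Fin 2) ℝ)).subgroupOf 𝒮ℒ) * volume 𝒟 := by
  have h := setLIntegral_fd_sum_eq_setLIntegral_iUnion g hg (G := fun _ ↦ (1 : ℝ≥0∞))
    measurable_const
  simp only [Finset.sum_const, Finset.card_univ, nsmul_eq_mul, mul_one, lintegral_const,
    Measure.restrict_apply_univ, one_mul] at h
  exact h.symm

include hg in
/-- **Volume of `X₀(N)`: `vol(⋃_q g_q⁻¹ 𝒟ᵒ) = [SL₂(ℤ) : Γ₀(N)] · π/3`** for the hyperbolic measure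
`dx dy / y²` (Diamond–Shurman (5.15), p. 182: `V_Γ = [SL₂(ℤ) : {±I}Γ] · V_{SL₂(ℤ)}`, here with
`-I ∈ Γ₀(N)` and `V_{SL₂(ℤ)} = vol(𝒟) = π/3`, `Literature.NumberTheory.Automorphic.volume_modular_fd`).
[cite: DiamondShurman2005, §5.4, (5.15), p. 182] -/
theorem volume_gamma0Domain [NeZero N] :
    volume (⋃ q, {τ : ℍ | g q • τ ∈ 𝒟ᵒ}) = (Gamma0 N).index * ENNReal.ofReal (π / 3) := by
  letI := Fintype.ofFinite (↥𝒮ℒ ⧸ (Gamma0 N : Subgroup (GL (Fin 2) ℝ)).subgroupOf 𝒮ℒ)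
  rw [volume_iUnion_setOf_smul_mem_fdo g hg, Automorphic.volume_modular_fd,
    ← natCard_quotient_subgroupOf_eq_index (Gamma0 N), Nat.card_eq_fintype_card]

include hg in
/-- `vol(X₀(N)) = ψ(N) · π/3` as a real number, with the explicit index
`ψ(N) = [SL₂(ℤ) : Γ₀(N)] = ∏_{p^e ∥ N} p^{e-1}(p + 1)` (`gamma0Index`,
`index_gamma0_eq_gamma0Index_holds`; Diamond–Shurman (5.15), p. 182).
[cite: DiamondShurman2005, §5.4, (5.15), p. 182] -/
theorem volume_gamma0Domain_toReal [NeZero N] :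
    (volume (⋃ q, {τ : ℍ | g q • τ ∈ 𝒟ᵒ})).toReal = gamma0Index N * (π / 3) := by
  have hι : (Gamma0 N).index = gamma0Index N := index_gamma0_eq_gamma0Index_holds N
  rw [volume_gamma0Domain g hg, hι, ENNReal.toReal_mul, ENNReal.toReal_natCast,
    ENNReal.toReal_ofReal (by positivity)]

include hg in
/-- **Cai–Shu–Tian 2014, Lemma 2.2, case `F = ℚ`, `B = M₂(ℚ)`, `U = U₀(N)`** (L. Cai, J. Shu,
Y. Tian, *Explicit Gross–Zagier and Waldspurger formulae*, Algebra Number Theory 8 (2014),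
Lemma 2.2, second display).  Printed: for `U ⊆ B̂^×` open compact containing `𝒪̂^×`,
`Vol(X_U) = 2 (4π²)^{-d} |D_F|^{-1/2} h_F Vol(U)⁻¹`, the volume of `X_U` being taken with the
measure `dx dy / (4π y²)` on `ℋ₂` (loc. cit. §1, before Thm. 1.5) and `Vol(U)` with the Tamagawa
measure normalised by `Vol(GL₂(𝒪_v)) = L(2, 1_v)⁻¹ Vol(𝒪_v)⁴`.  Here `F = ℚ`, `d = 1`,
`X_{U₀(N)} = Γ₀(N) \ ℋ` with fundamental domain `⋃_q g_q⁻¹ 𝒟ᵒ`, `D_ℚ = NumberField.discr ℚ`,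
`h_ℚ = NumberField.classNumber ℚ`, and `Vol(U₀(N)) = ∏_p (1 - p⁻²) / [GL₂(ℤ_p) : U₀(N)_p]
= ζ(2)⁻¹ / ψ(N)` is entered as the real number `(riemannZeta 2).re⁻¹ / gamma0Index N`
(`ψ(N) = [SL₂(ℤ) : Γ₀(N)] = [GL₂(ℤ̂) : U₀(N)]`).  Proof: both sides equal `ψ(N) / 12`
(`volume_gamma0Domain_toReal`, Mathlib `riemannZeta_two`, `Rat.numberField_discr`,
`Rat.classNumber_eq`). [cite: CaiShuTian2014, Lemma 2.2] -/
theorem CaiShuTian2014_vol_X0_eq [NeZero N] :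
    (volume (⋃ q, {τ : ℍ | g q • τ ∈ 𝒟ᵒ})).toReal / (4 * π) =
      2 * (4 * π ^ 2)⁻¹ * |(NumberField.discr ℚ : ℝ)| ^ (-(1 / 2 : ℝ)) *
        NumberField.classNumber ℚ * ((riemannZeta 2).re⁻¹ / gamma0Index N)⁻¹ := by
  have hζ : (riemannZeta 2).re = π ^ 2 / 6 := by
    rw [riemannZeta_two]
    norm_cast
  rw [volume_gamma0Domain_toReal g hg, Rat.numberField_discr, Rat.classNumber_eq, hζ]
  have hπ : (π : ℝ) ≠ 0 := Real.pi_ne_zero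
  simp only [Int.cast_one, abs_one, Real.one_rpow, Nat.cast_one, mul_one, inv_div]
  field_simp
  ring

include hg in
/-- Cai–Shu–Tian 2014, Lemma 2.2 for `F = ℚ`, `U = U₀(N)`, evaluated:
`Vol(X₀(N)) = vol(Γ₀(N) \ ℋ) / (4π) = ψ(N) / 12` (`= 2 (4π²)⁻¹ ζ(2) ψ(N)`).
[cite: CaiShuTian2014, Lemma 2.2] -/
theorem CaiShuTian2014_vol_X0_eq_div_twelve [NeZero N] :
    (volume (⋃ q, {τ : ℍ | g q • τ ∈ 𝒟ᵒ})).toReal / (4 * π) = gamma0Index N / 12 := by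
  rw [volume_gamma0Domain_toReal g hg]
  have hπ : (π : ℝ) ≠ 0 := Real.pi_ne_zero
  field_simp
  ring

end VolumeLeaf

section Unconditional

/-! ### The printed formula and `gross_zagier` are equivalent outright -/

open ModularForms

variable {N : ℕ} [NeZero N] {W : WeierstrassCurve ℚ} {K : Type u} [Field K] [NumberField K]

/-- Cai–Shu–Tian 2014, Thm. 1.1 (`χ = 1`, printed Petersson/degree normalisation) implies the
period-normalised `Literature.NumberTheory.EllipticCurves.gross_zagier` (Gross 1991, (1.1)),
unconditionally: the conversion `8π² (f,f)/deg f = ‖ω‖²/c²` is Zagier's identity, now the theorem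
`ModularParametrizationData.zagier_degree_formula_holds` (`ModularDegreeFormulaProofs.lean`).
[cite: CaiShuTian2014, Thm. 1.1] -/
theorem gross_zagier_of_CaiShuTian2014 (h : CaiShuTian2014_explicitGrossZagier N W K) :
    gross_zagier N W K :=
  gross_zagier_of_explicit h fun Dt ↦ Dt.zagier_degree_formula_holds

/-- Conversely `gross_zagier` gives back the printed formula of Cai–Shu–Tian 2014, Thm. 1.1
(`χ = 1`), unconditionally (Zagier's identity `zagier_degree_formula_holds`).
[cite: CaiShuTian2014, Thm. 1.1] -/
theorem CaiShuTian2014_explicitGrossZagier_of_gross_zagier (h : gross_zagier N W K) :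
    CaiShuTian2014_explicitGrossZagier N W K :=
  explicitGrossZagier_of_gross_zagier h fun Dt ↦ Dt.zagier_degree_formula_holds

/-- **`CaiShuTian2014_explicitGrossZagier N W K ↔ gross_zagier N W K`** with no side hypothesis:
the two vendored normalisations of the Gross–Zagier formula for `χ = 1` (Cai–Shu–Tian 2014,
Thm. 1.1, `8π²(φ,φ)/(u²√|D|) · ĥ/deg f`, and Gross 1991, (1.1), `‖ω‖²/(c² u² √|D|) · ĥ`) are
equivalent named facts, the bridge `4π² c² (f,f) = deg(φ) covol(Λ_E)` (Zagier 1985, §1) being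
proved in the tree (`ModularParametrizationData.zagier_degree_formula_holds`).  A discharge of
either fact therefore discharges the other. [cite: CaiShuTian2014, Thm. 1.1] -/
theorem CaiShuTian2014_explicitGrossZagier_iff_gross_zagier :
    CaiShuTian2014_explicitGrossZagier N W K ↔ gross_zagier N W K :=
  explicitGrossZagier_iff_gross_zagier fun Dt ↦ Dt.zagier_degree_formula_holds

end Unconditional

end Literature.NumberTheory.EllipticCurves

end
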